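import Summits.QuantumFields.BalabanUV.T4Continuum.Support.SmoothRefineOfApprox
import Summits.QuantumFields.BalabanUV.T4Continuum.Support.MinimalActionLimit
import HarnessLib

/-!
# T⁴ programme, node NE3 — THE ACTION SANDWICH, capstone of route (A): the minimal actions CONVERGE with a
# geometric tail from B11-Theorem-1-TYPE hypotheses and the kinematic leaf `ApproxRefine` alone

NE3 prover lineage P1, gen 17 (cell `pub-balaban`, unit `b2b-balaban-t4-ne3-p1`, row NE3 OWNER).  Packaging, for the
consumers of node U1b (U6 Cauchy sum, the typer's `Spine/NE3/LeafIndex`), of what the owner chain now proves: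
* `sandwichData_sfClass_of_approxRefine` — the sandwich data of a datum `V` from (H1) existence of minimisers,
  (H3ˢᵘᵖ) their sup-form regularity, (H0) the datum's level-0 regularity, and `ApproxRefine` (leaf R1, OURS∕crew);
* **`exists_tendsto_minAct_of_approxRefine`** — under the same hypotheses the minimal level-`k` actions `A_k(V)`
  CONVERGE and `|A_k(V) − A| ≤ [wallConstNA(d,L)(gradConst d (max c c′) + (max b b′)³)/L²]·N^d·(L⁻²)^k/(1 − L⁻²)`
  (`b′ = b₁ + 8mL³/g`, `c′ = c₁ + 36mL³/g`, `g = gap d L`; `L ≥ 2`) — `MinimalActionLimit.exists_tendsto_minAct_tail`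
  BY NAME;
* `actionHalf_of_approxRefine` — the ACTION half of the node's shape with an honest rate: `0 ≤ L⁻² < 1 ∧ ActionRate …`.

HONEST FRAMING.  Composition of landed modules only; **NE3 is NOT proved**: (H1)(H3ˢᵘᵖ)(H0) are B11-Theorem-1-TYPE
hypothesis shapes and `ApproxRefine` is the crew's open kinematic construction; the LOCAL half (`LocalRate`, readings
(D)∕(F)) is untouched.  No conditional of the cell (`BetaPertH`, (B), (B^μ)) used or hidden; nothing bears on infinite
volume, a mass gap, or the Clay problem; finite T⁴ rung (B)+1.  No `sorry`, no axioms beyond Mathlib's.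
-/

set_option autoImplicit false

open scoped BigOperators Matrix Matrix.Norms.L2Operator
open NormedSpace Filter Topology

namespace Summit.QuantumFields.BalabanUV.T4Continuum.MinimalActionCapstone

open Literature.MathematicalPhysics.QuantumFieldTheory.Balaban1983to89
open B7Prop1Explicit B7Prop2Explicit
open T4AveragingDeficitWall hiding Site Plane Plaq Bond
open T4AveragingDeficitNonAbelian (wallConstNA)
open T4EtaRateMin (Readings ActionRate)
open MinimalActionSandwich MinimalActionRate MinimalActionRefine MinimalActionLimit SmoothRefineOfApprox ChainEndFix

noncomputable section

variable {d : ℕ} {n : Type*} [Fintype n] [DecidableEq n] [Nonempty n]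

/-- **`SandwichData` for the small-field class from B11-Theorem-1-TYPE hypotheses and `ApproxRefine`.** [folklore] -/
theorem sandwichData_sfClass_of_approxRefine {L N : ℕ} (hL : 1 ≤ L) {b c b₁ c₁ m ε : ℝ} (hb : 0 ≤ b)
    (hb₁ : 0 ≤ b₁) (hm : 0 ≤ m) (hbs : 512 * (d + 1) * (d + 4) * (L : ℝ) ^ 2 * b ≤ 1)
    (hbε : b + 226 * (8 * (d + 1) * (d + 4)) ^ 2 * b ^ 2 ≤ ε)
    (hbs₁ : 512 * (d + 1) * (d + 4) * (L : ℝ) ^ 2 * b₁ ≤ 1)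
    (hgap : 4 * (2 * (8 * (d + 1) * (d + 4) * (L : ℝ) ^ 2 * b₁) + 2 * m / gap d L) ≤ gap d L)
    (hhalf : b₁ + 8 * m / gap d L ≤ 1 / 2) (hε : b₁ + 8 * m * (L : ℝ) ^ 3 / gap d L ≤ ε)
    {V : Site d → Fin d → (Matrix n n ℂ)ˣ}
    (h1 : ∀ k : ℕ, ∃ U, IsMinimiser d (sfClass d L N ε) L N k V U)
    (h3 : ∀ (k : ℕ) (U : Site d → Fin d → (Matrix n n ℂ)ˣ),
      IsMinimiser d (sfClass d L N ε) L N (k + 1) V U → RegularSup d L N b c (k + 1) U)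
    (h0 : RegularSup d L N b c 0 V)
    (hA : ApproxRefine d (sfClass (n := n) d L N ε) L N b c b₁ c₁ m) :
    SandwichData d (sfClass d L N ε) L N (max b (b₁ + 8 * m * (L : ℝ) ^ 3 / gap d L))
      (gradConst d (max c (c₁ + 36 * m * (L : ℝ) ^ 3 / gap d L))) V :=
  sandwichData_sfClass_of_smoothRefine hL hb hbs hbε h1 h3 h0 (smoothRefine_of_approxRefine hL hb₁ hm hbs₁ hgap hhalf hε hA)

/-- **THE MINIMAL ACTIONS CONVERGE WITH A GEOMETRIC TAIL** (route (A) of NE3, capstone): for `L ≥ 2`, `N ≥ 1` and a datum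
`V` with (H1) minimisers at every level, (H3ˢᵘᵖ) sup-form regular minimisers, (H0) level-0 regularity, given the kinematic
leaf `ApproxRefine` and the displayed smallness conditions, `A_k(V) → A` and
`|A_k(V) − A| ≤ [wallConstNA(d,L)(gradConst d (max c c′) + (max b b′)³)/L²]·N^d·(L⁻²)^k/(1 − L⁻²)`. [folklore] -/
theorem exists_tendsto_minAct_of_approxRefine {L N : ℕ} (hL : 2 ≤ L) (hN : 1 ≤ N) {b c b₁ c₁ m ε : ℝ} (hb : 0 ≤ b)
    (hb₁ : 0 ≤ b₁) (hm : 0 ≤ m)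
    (hBs : 512 * (d + 1) * (d + 4) * (L : ℝ) ^ 2 * max b (b₁ + 8 * m * (L : ℝ) ^ 3 / gap d L) ≤ 1)
    (hbε : b + 226 * (8 * (d + 1) * (d + 4)) ^ 2 * b ^ 2 ≤ ε)
    (hbs₁ : 512 * (d + 1) * (d + 4) * (L : ℝ) ^ 2 * b₁ ≤ 1)
    (hgap : 4 * (2 * (8 * (d + 1) * (d + 4) * (L : ℝ) ^ 2 * b₁) + 2 * m / gap d L) ≤ gap d L)
    (hhalf : b₁ + 8 * m / gap d L ≤ 1 / 2) (hε : b₁ + 8 * m * (L : ℝ) ^ 3 / gap d L ≤ ε)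
    {V : Site d → Fin d → (Matrix n n ℂ)ˣ}
    (h1 : ∀ k : ℕ, ∃ U, IsMinimiser d (sfClass d L N ε) L N k V U)
    (h3 : ∀ (k : ℕ) (U : Site d → Fin d → (Matrix n n ℂ)ˣ),
      IsMinimiser d (sfClass d L N ε) L N (k + 1) V U → RegularSup d L N b c (k + 1) U)
    (h0 : RegularSup d L N b c 0 V)
    (hA : ApproxRefine d (sfClass (n := n) d L N ε) L N b c b₁ c₁ m) :
    ∃ A : ℝ, Tendsto (fun k => minAct d (sfClass d L N ε) L N k V) atTop (𝓝 A) ∧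
      ∀ k : ℕ, |minAct d (sfClass d L N ε) L N k V - A|
        ≤ wallConstNA d L * (gradConst d (max c (c₁ + 36 * m * (L : ℝ) ^ 3 / gap d L))
            + (max b (b₁ + 8 * m * (L : ℝ) ^ 3 / gap d L)) ^ 3) / (L : ℝ) ^ 2 * (N : ℝ) ^ d
            * (((L : ℝ) ^ 2)⁻¹) ^ k / (1 - ((L : ℝ) ^ 2)⁻¹) := by
  have hL1 : 1 ≤ L := by omega
  have hbs : 512 * (d + 1) * (d + 4) * (L : ℝ) ^ 2 * b ≤ 1 := by
    have h0 : (0 : ℝ) ≤ 512 * (d + 1) * (d + 4) * (L : ℝ) ^ 2 := by positivity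
    exact (mul_le_mul_of_nonneg_left (le_max_left _ _) h0).trans hBs
  exact exists_tendsto_minAct_tail hL hN (le_max_of_le_left hb) hBs
    (sandwichData_sfClass_of_approxRefine hL1 hb hb₁ hm hbs hbε hbs₁ hgap hhalf hε h1 h3 h0 hA)

/-- **THE ACTION HALF OF THE NODE'S SHAPE WITH AN HONEST RATE**: `0 ≤ L⁻² < 1` together with
`ActionRate (minActReadings (sfClass …) … dom loc) (…) (L⁻²)` on every `dom` of data satisfying (H1)(H3ˢᵘᵖ)(H0), given
`ApproxRefine` — i.e. the first three clauses of `T4EtaRateMin.NE3Shape` for the minimal-action readings (the fourth,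
`LocalRate`, is the open local half, readings (D)∕(F)). [folklore] -/
theorem actionHalf_of_approxRefine {L N : ℕ} (hL : 2 ≤ L) (hN : 1 ≤ N) {b c b₁ c₁ m ε : ℝ} (hb : 0 ≤ b)
    (hb₁ : 0 ≤ b₁) (hm : 0 ≤ m)
    (hBs : 512 * (d + 1) * (d + 4) * (L : ℝ) ^ 2 * max b (b₁ + 8 * m * (L : ℝ) ^ 3 / gap d L) ≤ 1)
    (hbε : b + 226 * (8 * (d + 1) * (d + 4)) ^ 2 * b ^ 2 ≤ ε)
    (hbs₁ : 512 * (d + 1) * (d + 4) * (L : ℝ) ^ 2 * b₁ ≤ 1)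
    (hgap : 4 * (2 * (8 * (d + 1) * (d + 4) * (L : ℝ) ^ 2 * b₁) + 2 * m / gap d L) ≤ gap d L)
    (hhalf : b₁ + 8 * m / gap d L ≤ 1 / 2) (hε : b₁ + 8 * m * (L : ℝ) ^ 3 / gap d L ≤ ε)
    {dom : Set (Site d → Fin d → (Matrix n n ℂ)ˣ)}
    (h1 : ∀ V ∈ dom, ∀ k : ℕ, ∃ U, IsMinimiser d (sfClass d L N ε) L N k V U)
    (h3 : ∀ V ∈ dom, ∀ (k : ℕ) (U : Site d → Fin d → (Matrix n n ℂ)ˣ),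
      IsMinimiser d (sfClass d L N ε) L N (k + 1) V U → RegularSup d L N b c (k + 1) U)
    (h0 : ∀ V ∈ dom, RegularSup d L N b c 0 V)
    (hA : ApproxRefine d (sfClass (n := n) d L N ε) L N b c b₁ c₁ m)
    {X : Type*} (loc : ℕ → (Site d → Fin d → (Matrix n n ℂ)ˣ) → X → ℝ) :
    0 ≤ ((L : ℝ) ^ 2)⁻¹ ∧ ((L : ℝ) ^ 2)⁻¹ < 1 ∧
      ActionRate (minActReadings d (sfClass d L N ε) L N dom loc)
        (wallConstNA d L * (gradConst d (max c (c₁ + 36 * m * (L : ℝ) ^ 3 / gap d L))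
          + (max b (b₁ + 8 * m * (L : ℝ) ^ 3 / gap d L)) ^ 3) / (L : ℝ) ^ 2) (((L : ℝ) ^ 2)⁻¹) :=
  ⟨(rate_lt_one hL).1, (rate_lt_one hL).2,
    actionRate_sfClass_of_approxRefine (by omega) hN hb hb₁ hm hBs hbε hbs₁ hgap hhalf hε h1 h3 h0 hA loc⟩

end

end Summit.QuantumFields.BalabanUV.T4Continuum.MinimalActionCapstone
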